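import Summits.CriticalPhenomena.PercolationContinuityZ3.Theorems.PercNearOneGluingNoHeavyLowerTailSahiCombTriWPairLocal

/-!
# The DIAGONAL pair-local certificate: a structure identity for the thin-edge functional on arbitrary pairs, and the ASSIGNMENT / LIFT criterion
# (`TriWIneq` for `P` from a three-up-set inequality)

Support file of the one-cut programme (crux `NoHeavyLowerTail`, stmt-CriticalPhenomena-4575; cell `prim-masterthm`, seat P5 gen 23;
memo `FROM-prim-masterthm-p5-g23-PAIR-LOCAL.md` §8–9).  Continuation of `…SahiCombTriWPairLocal` (the pair-local principle) and `…SahiCombTriWPunctured`.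

Write `δ = sgnDiff F F'`, `ε = sgnDiff G G'` for two ARBITRARY pairs of up-sets of the fibre cube `W = Finset γ` and `P ⊆ W`.  STRUCTURE IDENTITY
(`FiveUpSet.triWOne_eq_diag`): the thin-edge functional of `…SahiCombFiveUpSetTriW` on these pairs is

  `triWOne P F F' G G' = Σ_{e∈P} (2 − [eᶜ∈P])·δ(e)ε(e) − Σ_{e∈P, eᶜ∉P} δ(eᶜ)ε(eᶜ) + [Kl_{P∩G'}(F) + Kl'_{P∩F}(G') + Kl_{P∩G}(F') + Kl'_{P∩F'}(G)]`

with the relative Kleitman gaps `Kl_{P∩B}(A) = #(P∩A∩B) − #(P∩refl A∩B)`, `Kl'_{P∩A}(B) = #(P∩A∩B) − #(P∩A∩refl B)` (non-negative for up-sets, `klL_nonneg`,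
`klR_nonneg`) — only the two CROSSED pairs `(F,G')`, `(F',G)` appear.  Consequence (`FiveUpSet.triW_nonneg_of_assign`, the ASSIGNMENT CRITERION): let
`φ : W → W` map every `d ∈ refl P \ P` to a point `φ d ∈ P` with `d ⊆ φ d`, let `n_e = #{d ∈ refl P \ P | φ d = e}` and suppose the weights
`c_e = 2 − [eᶜ∈P] − n_e` are `≥ 0` on `P` and the LIFT inequality

  `(LIFT)  #{d ∈ refl P \ P | φ d ∈ A ∩ B, d ∉ A ∩ B} ≤ Kl_{P∩B}(A) + Kl'_{P∩A}(B)`   for all up-sets `A, B` of `W`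

holds.  Then `0 ≤ triW P F G` for EVERY index cube and all monotone families (via `PairLocalCert P 1 κ_φ` with the DIAGONAL weight `κ_φ(e,e) = c_e`,
and `triW_nonneg_of_pairLocalCert`).  For principal `P = ↑m` (`φ d = d ∪ m`, `c ≡ 1`) (LIFT) is prim-lf-1's relative Kleitman lemma on the face; exact
checks (code23/c/lift.c, memo §9): EVERY up-set of `2^4` outside the `K₂₂`-orbit and 57 of 60 random up-sets of `2^5` admit such a `φ`.

* `FiveUpSet.klL`, `klR`, `klL_nonneg`, `klR_nonneg` — the two relative gaps;
* `FiveUpSet.card_inter_inter_eq_sum_ibit`, `triWOne_eq_sum_pt` — the thin-edge functional as a sum over `P` of a polynomial in membership bits;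
* **`FiveUpSet.triWOne_eq_diag`** — the structure identity;
* `FiveUpSet.kapDiag`, `sum_sum_kapDiag` — the diagonal weight and the collapse of the certificate double sum;
* **`FiveUpSet.pairLocalCert_of_assign`**, **`FiveUpSet.triW_nonneg_of_assign`** — the criterion.
HONEST LABEL: complete proofs, std axioms; a criterion (new proof architecture), not a proof of `TriWIneq` — which `P` admit an assignment with (LIFT), and a
proof of (LIFT) beyond principal `P`, stay OPEN. [this work]
-/

namespace Summit.CriticalPhenomena.PercolationContinuityZ3.Theorems

namespace FiveUpSet

open Finset

variable {β γ : Type} [DecidableEq β] [Fintype β] [DecidableEq γ] [Fintype γ]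

/-! ### Relative Kleitman gaps -/

/-- `Kl_{P∩B}(A) = #(P ∩ A ∩ B) − #(P ∩ refl A ∩ B)`. [this work] -/
def klL (P A B : Finset (Finset γ)) : ℤ := ((P ∩ A ∩ B).card : ℤ) - (P ∩ refl A ∩ B).card

/-- `Kl'_{P∩A}(B) = #(P ∩ A ∩ B) − #(P ∩ A ∩ refl B)`. [this work] -/
def klR (P A B : Finset (Finset γ)) : ℤ := ((P ∩ A ∩ B).card : ℤ) - (P ∩ A ∩ refl B).card

omit [DecidableEq β] [Fintype β] in
/-- Kleitman in the up-set `P ∩ B`: `Kl_{P∩B}(A) ≥ 0`. [this work] -/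
theorem klL_nonneg {P A B : Finset (Finset γ)} (hP : IsUpperSet (P : Set (Finset γ))) (hA : IsUpperSet (A : Set (Finset γ)))
    (hB : IsUpperSet (B : Set (Finset γ))) : 0 ≤ klL P A B := by
  have hU : IsUpperSet ((P ∩ B : Finset (Finset γ)) : Set (Finset γ)) := by rw [coe_inter]; exact hP.inter hB
  have h := card_inter_refl_le hU hA
  have e1 : P ∩ B ∩ refl A = P ∩ refl A ∩ B := by ext s; simp only [mem_inter]; tauto
  have e2 : P ∩ B ∩ A = P ∩ A ∩ B := by ext s; simp only [mem_inter]; tauto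
  rw [e1, e2] at h
  unfold klL; omega

omit [DecidableEq β] [Fintype β] in
/-- Kleitman in the up-set `P ∩ A`: `Kl'_{P∩A}(B) ≥ 0`. [this work] -/
theorem klR_nonneg {P A B : Finset (Finset γ)} (hP : IsUpperSet (P : Set (Finset γ))) (hA : IsUpperSet (A : Set (Finset γ)))
    (hB : IsUpperSet (B : Set (Finset γ))) : 0 ≤ klR P A B := by
  have hU : IsUpperSet ((P ∩ A : Finset (Finset γ)) : Set (Finset γ)) := by rw [coe_inter]; exact hP.inter hA
  have h := card_inter_refl_le hU hB
  unfold klR; omega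

/-! ### Cards as sums over `P` of membership bits -/

/-- `0/1` indicator as an integer. [this work] -/
def ibit (p : Prop) [Decidable p] : ℤ := if p then 1 else 0

omit [DecidableEq β] [Fintype β] [Fintype γ] in
/-- `#(P ∩ X ∩ Y) = Σ_{e∈P} [e∈X][e∈Y]`. [this work] -/
theorem card_inter_inter_eq_sum_ibit (P X Y : Finset (Finset γ)) :
    ((P ∩ X ∩ Y).card : ℤ) = ∑ e ∈ P, ibit (e ∈ X) * ibit (e ∈ Y) := by
  have h : ∀ e, ibit (e ∈ X) * ibit (e ∈ Y) = if e ∈ X ∩ Y then (1 : ℤ) else 0 := by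
    intro e; unfold ibit; by_cases h1 : e ∈ X <;> by_cases h2 : e ∈ Y <;> simp [h1, h2]
  rw [Finset.sum_congr rfl (fun e _ => h e), Finset.sum_boole]
  congr 1
  rw [inter_assoc, ← filter_mem_eq_inter]

omit [DecidableEq β] [Fintype β] in
/-- Membership in `X.image (complEquiv γ)` is membership of the complement. [this work] -/
theorem mem_image_complEquiv {X : Finset (Finset γ)} {e : Finset γ} : e ∈ X.image (complEquiv γ) ↔ eᶜ ∈ X := by
  rw [image_complEquiv, mem_refl]

omit [DecidableEq β] [Fintype β] in
/-- **The thin-edge functional as a sum over `P`** of a polynomial in the eight membership bits of `e` and `eᶜ`. [this work] -/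
theorem triWOne_eq_sum_pt (P F F' G G' : Finset (Finset γ)) :
    LatticeFiveUpSet.triWOne (complEquiv γ) P F F' G G'
      = ∑ e ∈ P, (2 * (ibit (e ∈ F) * ibit (e ∈ G) + ibit (e ∈ F') * ibit (e ∈ G'))
          - (ibit (eᶜ ∈ F) * ibit (e ∈ G') + ibit (eᶜ ∈ F') * ibit (e ∈ G))
          - (ibit (e ∈ F) * ibit (eᶜ ∈ G') + ibit (e ∈ F') * ibit (eᶜ ∈ G))
          - (ibit (eᶜ ∈ F) * ibit (eᶜ ∈ G) + ibit (eᶜ ∈ F') * ibit (eᶜ ∈ G'))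
          + (ibit (eᶜ ∈ F) * ibit (eᶜ ∈ G') + ibit (eᶜ ∈ F') * ibit (eᶜ ∈ G))) := by
  unfold LatticeFiveUpSet.triWOne
  have hc : ∀ X Y : Finset (Finset γ), ((P ∩ X ∩ Y).card : ℤ) = ∑ e ∈ P, ibit (e ∈ X) * ibit (e ∈ Y) := card_inter_inter_eq_sum_ibit P
  simp only [hc]
  have hm : ∀ (X : Finset (Finset γ)) (e : Finset γ), ibit (e ∈ X.image (complEquiv γ)) = ibit (eᶜ ∈ X) := by
    intro X e; unfold ibit; simp only [mem_image_complEquiv]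
  simp only [hm]
  simp only [Finset.sum_add_distrib, Finset.sum_sub_distrib, ← Finset.mul_sum]

/-! ### The structure identity -/

omit [DecidableEq β] [Fintype β] in
/-- An antipodally closed sub-family carries no antisymmetric sum: `Σ_{e∈S} (g e − g eᶜ) = 0` if `S` is closed under complement. [this work] -/
theorem sum_sub_compl_eq_zero (S : Finset (Finset γ)) (hS : ∀ e ∈ S, eᶜ ∈ S) (g : Finset γ → ℤ) :
    ∑ e ∈ S, (g e - g eᶜ) = 0 := by
  rw [Finset.sum_sub_distrib, sub_eq_zero]
  symm
  refine Finset.sum_nbij' (fun e => eᶜ) (fun e => eᶜ) (fun e he => hS e he) (fun e he => hS e he)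
    (fun e _ => compl_compl e) (fun e _ => compl_compl e) (fun e _ => rfl)

omit [DecidableEq β] [Fintype β] in
/-- **Structure identity for the thin-edge functional on arbitrary pairs** (`δ = sgnDiff F F'`, `ε = sgnDiff G G'`):
`triWOne P F F' G G' = Σ_{e∈P}(2 − [eᶜ∈P])δ(e)ε(e) − Σ_{e∈P}[eᶜ∉P]δ(eᶜ)ε(eᶜ) + Kl_{P∩G'}(F) + Kl'_{P∩F}(G') + Kl_{P∩G}(F') + Kl'_{P∩F'}(G)`. [this work] -/
theorem triWOne_eq_diag (P F F' G G' : Finset (Finset γ)) :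
    LatticeFiveUpSet.triWOne (complEquiv γ) P F F' G G'
      = (∑ e ∈ P, (2 - ibit (eᶜ ∈ P)) * sgnDiff F F' e * sgnDiff G G' e)
        - (∑ e ∈ P, (1 - ibit (eᶜ ∈ P)) * sgnDiff F F' eᶜ * sgnDiff G G' eᶜ)
        + (klL P F G' + klR P F G' + klL P F' G + klR P F' G) := by
  -- everything as a sum over `P`
  have hK : klL P F G' + klR P F G' + klL P F' G + klR P F' G
      = ∑ e ∈ P, ((ibit (e ∈ F) - ibit (eᶜ ∈ F)) * ibit (e ∈ G') + ibit (e ∈ F) * (ibit (e ∈ G') - ibit (eᶜ ∈ G'))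
          + (ibit (e ∈ F') - ibit (eᶜ ∈ F')) * ibit (e ∈ G) + ibit (e ∈ F') * (ibit (e ∈ G) - ibit (eᶜ ∈ G))) := by
    unfold klL klR
    have hr : ∀ (X : Finset (Finset γ)) (e : Finset γ), ibit (e ∈ refl X) = ibit (eᶜ ∈ X) := by
      intro X e; unfold ibit; simp only [mem_refl]
    simp only [card_inter_inter_eq_sum_ibit, hr, ← Finset.sum_add_distrib, ← Finset.sum_sub_distrib]
    refine Finset.sum_congr rfl fun e _ => ?_
    ring
  -- the antisymmetric correction vanishes on `P ∩ refl P`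
  have hZ : ∑ e ∈ P, ibit (eᶜ ∈ P) * (sgnDiff F F' e * sgnDiff G G' e - sgnDiff F F' eᶜ * sgnDiff G G' eᶜ) = 0 := by
    have hsplit : ∑ e ∈ P, ibit (eᶜ ∈ P) * (sgnDiff F F' e * sgnDiff G G' e - sgnDiff F F' eᶜ * sgnDiff G G' eᶜ)
        = ∑ e ∈ P.filter (fun e => eᶜ ∈ P), (sgnDiff F F' e * sgnDiff G G' e - sgnDiff F F' eᶜ * sgnDiff G G' eᶜ) := by
      rw [Finset.sum_filter]
      refine Finset.sum_congr rfl fun e _ => ?_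
      unfold ibit; split <;> simp
    rw [hsplit]
    exact sum_sub_compl_eq_zero _ (fun e he => by
      rw [mem_filter] at he ⊢; exact ⟨he.2, by rw [compl_compl]; exact he.1⟩) (fun e => sgnDiff F F' e * sgnDiff G G' e)
  rw [hK, triWOne_eq_sum_pt]
  rw [← sub_eq_zero]
  have : ∀ a b c d : ℤ, a - (b - c + d) = (a - b + c - d) := fun a b c d => by ring
  rw [this, ← Finset.sum_sub_distrib, ← Finset.sum_add_distrib, ← Finset.sum_sub_distrib, ← hZ]
  refine Finset.sum_congr rfl fun e _ => ?_
  unfold sgnDiff ibit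
  ring

/-! ### The diagonal weight and the assignment criterion -/

/-- Multiplicity of `e` as an assigned cover: `n_e = #{d ∈ refl P \ P | φ d = e}`. [this work] -/
def nAssign (P : Finset (Finset γ)) (φ : Finset γ → Finset γ) (e : Finset γ) : ℕ :=
  ((refl P \ P).filter fun d => φ d = e).card

/-- The DIAGONAL weight of an assignment: `κ_φ(u,e) = [u = e][e ∈ P]·(2 − [eᶜ∈P] − n_e)` (as a natural number; meaningful when `c_e ≥ 0`). [this work] -/
def kapDiag (P : Finset (Finset γ)) (φ : Finset γ → Finset γ) (u e : Finset γ) : ℕ :=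
  if u = e ∧ e ∈ P then 2 - (if eᶜ ∈ P then 1 else 0) - nAssign P φ e else 0

omit [DecidableEq β] [Fintype β] in
/-- Collapse of the certificate double sum for a diagonal weight. [this work] -/
theorem sum_sum_kapDiag (P : Finset (Finset γ)) (φ : Finset γ → Finset γ) (x y : Finset γ → ℤ) :
    ∑ u : Finset γ, ∑ e : Finset γ, (kapDiag P φ u e : ℤ) * x u * y e
      = ∑ e ∈ P, (kapDiag P φ e e : ℤ) * x e * y e := by
  have h1 : ∀ u : Finset γ, ∑ e : Finset γ, (kapDiag P φ u e : ℤ) * x u * y e = (kapDiag P φ u u : ℤ) * x u * y u := by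
    intro u
    rw [Finset.sum_eq_single u]
    · intro e _ hne
      have : kapDiag P φ u e = 0 := by unfold kapDiag; rw [if_neg]; exact fun h => hne h.1.symm
      rw [this]; simp
    · intro h; exact absurd (mem_univ u) h
  simp only [h1]
  rw [← Finset.sum_subset (subset_univ P)]
  intro e _ he
  have : kapDiag P φ e e = 0 := by unfold kapDiag; rw [if_neg]; exact fun h => he h.2
  rw [this]; simp

omit [DecidableEq β] [Fintype β] in
/-- `Σ_{e∈P} n_e · g e = Σ_{d ∈ refl P \ P} g (φ d)` when `φ` maps `refl P \ P` into `P`. [this work] -/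
theorem sum_nAssign_mul (P : Finset (Finset γ)) (φ : Finset γ → Finset γ) (hφ : ∀ d ∈ refl P \ P, φ d ∈ P) (g : Finset γ → ℤ) :
    ∑ e ∈ P, (nAssign P φ e : ℤ) * g e = ∑ d ∈ refl P \ P, g (φ d) := by
  unfold nAssign
  rw [← Finset.sum_fiberwise_of_maps_to (s := refl P \ P) (t := P) (g := φ) (fun d hd => hφ d hd) (fun d => g (φ d))]
  refine Finset.sum_congr rfl fun e _ => ?_
  rw [Finset.sum_congr rfl (fun d hd => by rw [(mem_filter.1 hd).2] : ∀ d ∈ (refl P \ P).filter (fun d => φ d = e), g (φ d) = g e)]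
  rw [Finset.sum_const, nsmul_eq_mul]

omit [DecidableEq β] [Fintype β] in
/-- The "lift excess" of a pair of up-sets is non-negative: `d ∈ A ∩ B ⟹ φ d ∈ A ∩ B` when `d ⊆ φ d`. [this work] -/
theorem card_filter_lift_le (P A B : Finset (Finset γ)) (φ : Finset γ → Finset γ)
    (hsub : ∀ d ∈ refl P \ P, d ⊆ φ d) (hA : IsUpperSet (A : Set (Finset γ))) (hB : IsUpperSet (B : Set (Finset γ))) :
    ((refl P \ P).filter (fun d => d ∈ A ∩ B)).card ≤ ((refl P \ P).filter (fun d => φ d ∈ A ∩ B)).card := by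
  refine card_le_card fun d hd => ?_
  rw [mem_filter] at hd ⊢
  refine ⟨hd.1, ?_⟩
  rw [mem_inter] at hd ⊢
  exact ⟨hA (hsub d hd.1) hd.2.1, hB (hsub d hd.1) hd.2.2⟩

/-- **The assignment criterion gives a pair-local certificate.**  `P` an up-set; `φ` maps each `d ∈ refl P \ P` to a point of `P` above it; the weights
`c_e = 2 − [eᶜ∈P] − n_e` are non-negative; and (LIFT) holds for all up-sets `A, B`.  Then `PairLocalCert P 1 (kapDiag P φ)`. [this work] -/
theorem pairLocalCert_of_assign (P : Finset (Finset γ)) (hP : IsUpperSet (P : Set (Finset γ))) (φ : Finset γ → Finset γ)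
    (hφP : ∀ d ∈ refl P \ P, φ d ∈ P) (hφsub : ∀ d ∈ refl P \ P, d ⊆ φ d)
    (hc : ∀ e ∈ P, nAssign P φ e + (if eᶜ ∈ P then 1 else 0) ≤ 2)
    (hLIFT : ∀ A B : Finset (Finset γ), IsUpperSet (A : Set (Finset γ)) → IsUpperSet (B : Set (Finset γ)) →
      ((((refl P \ P).filter (fun d => φ d ∈ A ∩ B)).card : ℤ) - ((refl P \ P).filter (fun d => d ∈ A ∩ B)).card
        ≤ klL P A B + klR P A B)) :
    PairLocalCert P 1 (kapDiag P φ) := by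
  intro F F' G G' hF hF' hG hG'
  rw [sum_sum_kapDiag, Nat.cast_one, one_mul, triWOne_eq_diag]
  -- the diagonal weight in closed form on `P`
  have hk : ∀ e ∈ P, (kapDiag P φ e e : ℤ) = 2 - ibit (eᶜ ∈ P) - (nAssign P φ e : ℤ) := by
    intro e he
    unfold kapDiag ibit
    rw [if_pos ⟨rfl, he⟩]
    have h2 := hc e he
    by_cases h : eᶜ ∈ P
    · rw [if_pos h] at h2
      rw [if_pos h, if_pos h]
      have hn : nAssign P φ e ≤ 1 := by omega
      have h3 : (2 : ℕ) - 1 - nAssign P φ e = 1 - nAssign P φ e := by omega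
      rw [h3, Nat.cast_sub hn]; push_cast; ring
    · rw [if_neg h] at h2
      rw [if_neg h, if_neg h]
      have hn : nAssign P φ e ≤ 2 := by omega
      have h3 : (2 : ℕ) - 0 - nAssign P φ e = 2 - nAssign P φ e := by omega
      rw [h3, Nat.cast_sub hn]; push_cast; ring
  rw [Finset.sum_congr rfl (fun e he => by rw [hk e he])]
  -- Σ_P n_e δε(e) = Σ_D δε(φ d)  and  Σ_P [eᶜ∉P] δε(eᶜ) = Σ_D δε(d)
  have hn : ∑ e ∈ P, (nAssign P φ e : ℤ) * (sgnDiff F F' e * sgnDiff G G' e)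
      = ∑ d ∈ refl P \ P, sgnDiff F F' (φ d) * sgnDiff G G' (φ d) :=
    sum_nAssign_mul P φ hφP (fun e => sgnDiff F F' e * sgnDiff G G' e)
  have hD : ∑ e ∈ P, (1 - ibit (eᶜ ∈ P)) * sgnDiff F F' eᶜ * sgnDiff G G' eᶜ
      = ∑ d ∈ refl P \ P, sgnDiff F F' d * sgnDiff G G' d := by
    have h1 : ∑ e ∈ P, (1 - ibit (eᶜ ∈ P)) * sgnDiff F F' eᶜ * sgnDiff G G' eᶜ
        = ∑ e ∈ P.filter (fun e => eᶜ ∉ P), sgnDiff F F' eᶜ * sgnDiff G G' eᶜ := by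
      rw [Finset.sum_filter]
      refine Finset.sum_congr rfl fun e _ => ?_
      unfold ibit; by_cases h : eᶜ ∈ P <;> simp [h]
    rw [h1]
    refine Finset.sum_nbij' (fun e => eᶜ) (fun d => dᶜ) ?_ ?_ (fun e _ => compl_compl e) (fun d _ => compl_compl d) (fun e _ => rfl)
    · intro e he
      rw [mem_filter] at he
      rw [mem_sdiff, mem_refl, compl_compl]
      exact ⟨he.1, he.2⟩
    · intro d hd
      rw [mem_sdiff, mem_refl] at hd
      rw [mem_filter, compl_compl]
      exact ⟨hd.1, hd.2⟩
  -- expand the four-family products over `D`:  δε = [F][G] − [F][G'] − [F'][G] + [F'][G']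
  have hprod : ∀ s : Finset γ, sgnDiff F F' s * sgnDiff G G' s
      = ibit (s ∈ F ∩ G) - ibit (s ∈ F ∩ G') - ibit (s ∈ F' ∩ G) + ibit (s ∈ F' ∩ G') := by
    intro s; unfold sgnDiff ibit
    by_cases h1 : s ∈ F <;> by_cases h2 : s ∈ F' <;> by_cases h3 : s ∈ G <;> by_cases h4 : s ∈ G' <;> simp [h1, h2, h3, h4, mem_inter]
  have hcnt : ∀ (X : Finset (Finset γ)) (f : Finset γ → Finset γ),
      ∑ d ∈ refl P \ P, ibit (f d ∈ X) = ((((refl P \ P).filter (fun d => f d ∈ X)).card : ℤ)) := by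
    intro X f; unfold ibit; rw [Finset.sum_boole]
  have hL1 := hLIFT F G' hF hG'
  have hL2 := hLIFT F' G hF' hG
  have hX1 := card_filter_lift_le P F G φ hφsub hF hG
  have hX2 := card_filter_lift_le P F' G' φ hφsub hF' hG'
  -- rewrite the two `D`-sums as counts
  have hE1 : ∑ d ∈ refl P \ P, sgnDiff F F' (φ d) * sgnDiff G G' (φ d)
      = ((((refl P \ P).filter (fun d => φ d ∈ F ∩ G)).card : ℤ)) - (((refl P \ P).filter (fun d => φ d ∈ F ∩ G')).card : ℤ)
        - (((refl P \ P).filter (fun d => φ d ∈ F' ∩ G)).card : ℤ) + (((refl P \ P).filter (fun d => φ d ∈ F' ∩ G')).card : ℤ) := by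
    simp only [hprod, Finset.sum_add_distrib, Finset.sum_sub_distrib, hcnt]
  have hE2 : ∑ d ∈ refl P \ P, sgnDiff F F' d * sgnDiff G G' d
      = ((((refl P \ P).filter (fun d => d ∈ F ∩ G)).card : ℤ)) - (((refl P \ P).filter (fun d => d ∈ F ∩ G')).card : ℤ)
        - (((refl P \ P).filter (fun d => d ∈ F' ∩ G)).card : ℤ) + (((refl P \ P).filter (fun d => d ∈ F' ∩ G')).card : ℤ) := by
    have := hcnt
    simp only [hprod, Finset.sum_add_distrib, Finset.sum_sub_distrib]
    simp only [show ∀ X : Finset (Finset γ), ∑ d ∈ refl P \ P, ibit (d ∈ X) = ((((refl P \ P).filter (fun d => d ∈ X)).card : ℤ)) from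
      fun X => hcnt X id]
  -- main estimate
  have hsplit : ∑ e ∈ P, (2 - ibit (eᶜ ∈ P) - (nAssign P φ e : ℤ)) * sgnDiff F F' e * sgnDiff G G' e
      = (∑ e ∈ P, (2 - ibit (eᶜ ∈ P)) * sgnDiff F F' e * sgnDiff G G' e)
        - ∑ e ∈ P, (nAssign P φ e : ℤ) * (sgnDiff F F' e * sgnDiff G G' e) := by
    rw [← Finset.sum_sub_distrib]
    refine Finset.sum_congr rfl fun e _ => ?_
    ring
  rw [hsplit, hn, hD, hE1, hE2]
  have k1 := klL_nonneg hP hF hG'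
  have k2 := klR_nonneg hP hF hG'
  have hX1' : ((((refl P \ P).filter (fun d => d ∈ F ∩ G)).card : ℤ)) ≤ ((refl P \ P).filter (fun d => φ d ∈ F ∩ G)).card := by
    exact_mod_cast hX1
  have hX2' : ((((refl P \ P).filter (fun d => d ∈ F' ∩ G')).card : ℤ)) ≤ ((refl P \ P).filter (fun d => φ d ∈ F' ∩ G')).card := by
    exact_mod_cast hX2
  linarith

/-- **`TriWIneq` for `P` from an assignment with (LIFT).**  Under the hypotheses of `pairLocalCert_of_assign`, `0 ≤ triW P F G` for EVERY index cube
and all monotone families of up-sets (pair-local principle). [this work] -/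
theorem triW_nonneg_of_assign (P : Finset (Finset γ)) (hP : IsUpperSet (P : Set (Finset γ))) (φ : Finset γ → Finset γ)
    (hφP : ∀ d ∈ refl P \ P, φ d ∈ P) (hφsub : ∀ d ∈ refl P \ P, d ⊆ φ d)
    (hc : ∀ e ∈ P, nAssign P φ e + (if eᶜ ∈ P then 1 else 0) ≤ 2)
    (hLIFT : ∀ A B : Finset (Finset γ), IsUpperSet (A : Set (Finset γ)) → IsUpperSet (B : Set (Finset γ)) →
      ((((refl P \ P).filter (fun d => φ d ∈ A ∩ B)).card : ℤ) - ((refl P \ P).filter (fun d => d ∈ A ∩ B)).card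
        ≤ klL P A B + klR P A B))
    (F G : Finset β → Finset (Finset γ))
    (hF : ∀ x, IsUpperSet (F x : Set (Finset γ))) (hG : ∀ x, IsUpperSet (G x : Set (Finset γ)))
    (hFm : Monotone F) (hGm : Monotone G) :
    0 ≤ triW P F G :=
  triW_nonneg_of_pairLocalCert (by norm_num) (pairLocalCert_of_assign P hP φ hφP hφsub hc hLIFT) F G hF hG hFm hGm

end FiveUpSet

end Summit.CriticalPhenomena.PercolationContinuityZ3.Theorems
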